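import Summits.Ventures.PercRepro.S1CellTableJ4
import Summits.Ventures.PercRepro.S1JointPerFlatL1
import Summits.Ventures.PercRepro.S1CoreFourCircuitSum

/-!
# PercRepro — S1 CELL TABLE WITH LEMMA T4⁺ AND LEVER L1: the core cells `(14, d)`, `5 ≤ d ≤ 15` at level `4` by kernel
evaluation (p2, gen 15; SUBCLAIM-S1 §5–§6 with LEMMAS J, J′, K, p1's T⁺⁺⁺ and T4⁺, and L1)

`S1CellTableJ4.cellOK6` with two more levers: p1 g21's LEMMA T4⁺ (`S1CoreFourCircuitSum.ncard_fourCircuits_le_fourCircuitBound`: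
`s₄ ≤ fourCircuitBound d = Σ_{j ≤ d} Σ_{i ≤ j} ⌊3i/2⌋ = 48 · 78 · 118 · 170` at `d = 5 … 8` on the `e`-free core, against
Lemma T4's `70 · 112 · 168 · 240`), and L1 (`S1FourSetsLower`: the size-`4` members of `U` number at most
`C(n, 4) − s₃(n − 3) − s₄`). To keep the cell inequality monotone in the circuit counts, the per-flat `U`-bound is
regrouped as `7560·C(n, 4) + c₃·s₃ + c₄·s₄ + c₅·s₅` with `c₃ = RSK d·C(n−3, 2) + (RBK d − RSK d)·C(m−3, 2) − 7560(n − 3)`,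
`c₄ = RSK d·(n − 4) + (RBK d − RSK d)·(m − 4) − 7560`, `c₅ = RSK d + (RBK d − RSK d)` (all non-negative for `n ≥ 6`).

* `cellOK7` — the cell inequality as one `Bool` in `ℕ`; `cellOK7_spec` — its meaning with ordinary binomials;
* **`table_14`** — the `11` cells `(14, d)`, `5 ≤ d ≤ 15` by `decide +kernel` (exact-integer twin: `mining/p2/g15/cellok8.py`;
  the tightest cell is `(14, 6)` at `Φ·U⁺/Y⁻ = 0.9984`);
* **`rls_of_cellOK7`** — a kernel-evaluated cell gives `ThmN.RLS M p 4` on the `e`-free core of rank `p ≥ 5` and corank `d ≥ 4`.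
Axioms: standard.
-/

open scoped Matroid

namespace PercRepro

namespace S1

open Set

variable {α : Type}

/-- **The cell inequality at `(p, d)` with Lemma T4⁺ and L1** as a decidable statement in `ℕ`. -/
def cellOK7 (p d : ℕ) : Bool :=
  let n := p + d
  let m := min (5 * d) n
  let s3 := min (d * (d + 1) / 2) ((d * d + 6 - 3 * d) / 2)
  let s4 := min (min (CoreRegimes.chooseF (d + 3) 4) (d * (d + 1) * (d + 2) / 3)) (fourCircuitBound d)
  let s5 := CoreRegimes.chooseF (d + 4) 5
  let piAll := s3 * CoreRegimes.chooseF (n - 3) 2 + s4 * (n - 4) + s5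
  let piS0 := s3 * CoreRegimes.chooseF (m - 3) 2 + s4 * (m - 4) + s5
  let sigs := ∑ j ∈ Finset.range (d - 5 + 1), Nat.choose 2 j
  let sig := ∑ j ∈ Finset.range (d - 5 + 1), Nat.choose 5 j
  let c3 := RSK d * CoreRegimes.chooseF (n - 3) 2 + (RBK d - RSK d) * CoreRegimes.chooseF (m - 3) 2 - 7560 * (n - 3)
  let c4 := RSK d * (n - 4) + (RBK d - RSK d) * (m - 4) - 7560
  let c5 := RSK d + (RBK d - RSK d)
  let U := min (7560 * CoreRegimes.chooseF n 4 + c3 * s3 + c4 * s4 + c5 * s5)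
    (7560 * (CoreRegimes.chooseF n 4 + sigs * piAll + (sig - sigs) * piS0))
  let R3 := 7560 * 22 * (s3 * (n - 3) + s4)
  let R4 := RSK 10 * piAll + (RBK 10 - RSK 10) * piS0
  let Ysum := 7560 * ∑ j ∈ Finset.Ico 5 p, CoreRegimes.chooseF n j
  let phiNum := 2 ^ (p + 4) - 2 * ∑ u ∈ Finset.range 5, CoreRegimes.chooseF (p + 4) u
  let phiDen := CoreRegimes.chooseF (p + 4) 4
  decide (R3 + R4 ≤ Ysum ∧ phiNum * U + phiDen * (R3 + R4) ≤ phiDen * Ysum)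

/-- The two inequalities behind `cellOK7`, with ordinary binomials. -/
theorem cellOK7_spec {p d : ℕ} (h : cellOK7 p d = true) :
    7560 * 22 * (min (d * (d + 1) / 2) ((d * d + 6 - 3 * d) / 2) * (p + d - 3) +
        min (min ((d + 3).choose 4) (d * (d + 1) * (d + 2) / 3)) (fourCircuitBound d)) +
      (RSK 10 * (min (d * (d + 1) / 2) ((d * d + 6 - 3 * d) / 2) * (p + d - 3).choose 2 +
          min (min ((d + 3).choose 4) (d * (d + 1) * (d + 2) / 3)) (fourCircuitBound d) * (p + d - 4) + (d + 4).choose 5) +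
        (RBK 10 - RSK 10) * (min (d * (d + 1) / 2) ((d * d + 6 - 3 * d) / 2) * (min (5 * d) (p + d) - 3).choose 2 +
          min (min ((d + 3).choose 4) (d * (d + 1) * (d + 2) / 3)) (fourCircuitBound d) * (min (5 * d) (p + d) - 4) + (d + 4).choose 5)) ≤
      7560 * ∑ j ∈ Finset.Ico 5 p, (p + d).choose j ∧
    (2 ^ (p + 4) - 2 * ∑ u ∈ Finset.range 5, (p + 4).choose u) *
        min (7560 * (p + d).choose 4 +
            (RSK d * (p + d - 3).choose 2 + (RBK d - RSK d) * (min (5 * d) (p + d) - 3).choose 2 - 7560 * (p + d - 3)) *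
              min (d * (d + 1) / 2) ((d * d + 6 - 3 * d) / 2) +
            (RSK d * (p + d - 4) + (RBK d - RSK d) * (min (5 * d) (p + d) - 4) - 7560) *
              min (min ((d + 3).choose 4) (d * (d + 1) * (d + 2) / 3)) (fourCircuitBound d) +
            (RSK d + (RBK d - RSK d)) * (d + 4).choose 5)
          (7560 * ((p + d).choose 4 +
            (∑ j ∈ Finset.range (d - 5 + 1), Nat.choose 2 j) *
              (min (d * (d + 1) / 2) ((d * d + 6 - 3 * d) / 2) * (p + d - 3).choose 2 +
                min (min ((d + 3).choose 4) (d * (d + 1) * (d + 2) / 3)) (fourCircuitBound d) * (p + d - 4) + (d + 4).choose 5) +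
            ((∑ j ∈ Finset.range (d - 5 + 1), Nat.choose 5 j) - (∑ j ∈ Finset.range (d - 5 + 1), Nat.choose 2 j)) *
              (min (d * (d + 1) / 2) ((d * d + 6 - 3 * d) / 2) * (min (5 * d) (p + d) - 3).choose 2 +
                min (min ((d + 3).choose 4) (d * (d + 1) * (d + 2) / 3)) (fourCircuitBound d) * (min (5 * d) (p + d) - 4) + (d + 4).choose 5))) +
      (p + 4).choose 4 *
        (7560 * 22 * (min (d * (d + 1) / 2) ((d * d + 6 - 3 * d) / 2) * (p + d - 3) +
            min (min ((d + 3).choose 4) (d * (d + 1) * (d + 2) / 3)) (fourCircuitBound d)) +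
          (RSK 10 * (min (d * (d + 1) / 2) ((d * d + 6 - 3 * d) / 2) * (p + d - 3).choose 2 +
              min (min ((d + 3).choose 4) (d * (d + 1) * (d + 2) / 3)) (fourCircuitBound d) * (p + d - 4) + (d + 4).choose 5) +
            (RBK 10 - RSK 10) * (min (d * (d + 1) / 2) ((d * d + 6 - 3 * d) / 2) * (min (5 * d) (p + d) - 3).choose 2 +
              min (min ((d + 3).choose 4) (d * (d + 1) * (d + 2) / 3)) (fourCircuitBound d) * (min (5 * d) (p + d) - 4) + (d + 4).choose 5))) ≤
      (p + 4).choose 4 * (7560 * ∑ j ∈ Finset.Ico 5 p, (p + d).choose j) := by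
  unfold cellOK7 at h
  simp only [CoreRegimes.chooseF_eq] at h
  exact of_decide_eq_true h

/-- **THE T4⁺ + L1 TABLE**: every cell `(14, d)`, `5 ≤ d ≤ 15` is closed (kernel evaluation of `11` cells). -/
theorem table_14' : ∀ d < 16, 5 ≤ d → cellOK7 14 d = true := by
  decide +kernel

/-- The table in the form of the spec. -/
theorem table_14 : ∀ d, 5 ≤ d → d ≤ 15 → cellOK7 14 d = true :=
  fun d hd hd' => table_14' d (by omega) hd

/-- `C(k, 2) ≥ k` for `k ≥ 3`. -/
theorem le_choose_two (k : ℕ) (hk : 3 ≤ k) : k ≤ k.choose 2 := by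
  rw [Nat.choose_two_right]
  have h1 : 2 * k ≤ k * (k - 1) := by
    have : 2 ≤ k - 1 := by omega
    calc 2 * k = k * 2 := by ring
      _ ≤ k * (k - 1) := Nat.mul_le_mul_left _ this
  omega

/-- **FROM THE T4⁺ + L1 CELL TO `RLS`**: on the `e`-free core of rank `p ≥ 5` and corank `d ≥ 4` (`|E| = p + d`), a
kernel-evaluated cell `cellOK7 p d = true` gives `ThmN.RLS M p 4`. -/
theorem rls_of_cellOK7 (M : Matroid α) [M.Finite] (p d : ℕ) (hd4 : 4 ≤ d) (hR : M.eRank = (p : ℕ∞))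
    (hn : M.E.ncard = p + d)
    (hfree : ∀ e ∈ M.E, ∃ A ⊆ M.E \ {e}, e ∉ M.closure A ∧ e ∉ M.closure ((M.E \ {e}) \ A))
    (hp : 5 ≤ p) (hok : cellOK7 p d = true) : ThmN.RLS M p 4 := by
  classical
  -- the core facts
  have hL : ∀ e ∈ M.E, ¬ M.IsLoop e := ThmN.not_isLoop_of_free M hfree
  have hs : ∀ e ∈ M.E, ∀ f ∈ M.E, e ≠ f → M.eRk {e, f} = 2 := by
    intro e he f hf hef
    have h2 : (2 : ℕ∞) ≤ M.eRk {e, f} :=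
      ThmN.two_le_eRk_of_two_le_ncard_of_free M hfree (pair_subset he hf) (by rw [ncard_pair hef])
    have h3 : M.eRk {e, f} ≤ 2 := by
      have := M.eRk_le_encard {e, f}
      rwa [encard_pair hef] at this
    exact le_antisymm h3 h2
  have hcirc : ∀ C, M.IsCircuit C → 3 ≤ C.encard := ThmN.three_le_encard_of_circuit M hL hs
  have hline : ∀ L ⊆ M.E, M.eRk L ≤ 2 → L.ncard ≤ 3 := by
    intro L hL' hr
    have := ThmN.ncard_add_one_le_two_pow_of_eRk_le M hL hfree 2 L hL' hr
    omega
  have hplane : ∀ P ⊆ M.E, M.eRk P ≤ 3 → P.ncard ≤ 6 := fun P hP hr =>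
    ThmN.ncard_le_six_of_eRk_le_three_of_free M hfree hP hr
  have hten : ∀ X ⊆ M.E, M.eRk X ≤ 4 → X.ncard ≤ 10 := fun X hX hr =>
    ThmN.ncard_le_ten_of_eRk_le_four_of_free M hfree hX hr
  have hd : M.E.encard = M.eRank + d := by
    rw [hR, ← M.ground_finite.cast_ncard_eq, hn]
    push_cast
    ring
  -- the counts
  set s3 := {C : Set α | M.IsCircuit C ∧ C.ncard = 3}.ncard with hs3
  set s4 := {C : Set α | M.IsCircuit C ∧ C.ncard = 4}.ncard with hs4
  set s5 := {C : Set α | M.IsCircuit C ∧ C.ncard = 5}.ncard with hs5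
  have hb3 : s3 ≤ min (d * (d + 1) / 2) ((d * d + 6 - 3 * d) / 2) := by
    have h := two_mul_ncard_triangles_le M (fun L hL hr => hline L hL hr.le) hd
    have h' : 2 * s3 ≤ d * (d + 1) := h
    have h2 := two_mul_ncard_triangles_add_three_mul_le_of_four_le M
      (fun L hL hr => hline L hL hr.le) hplane hd4 hd
    have h2' : 2 * s3 + 3 * d ≤ d * d + 6 := h2
    refine le_min ?_ ?_
    · rw [Nat.le_div_iff_mul_le (by norm_num)]; omega
    · rw [Nat.le_div_iff_mul_le (by norm_num)]; omega
  have hb4 : s4 ≤ min (min ((d + 3).choose 4) (d * (d + 1) * (d + 2) / 3)) (fourCircuitBound d) := by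
    refine le_min (le_min (ncard_circuits_four_le M hd) ?_) (ncard_fourCircuits_le_fourCircuitBound M hfree hd)
    have h := three_mul_ncard_four_circuits_le M hline hplane hd
    have h' : 3 * s4 ≤ d * (d + 1) * (d + 2) := h
    rw [Nat.le_div_iff_mul_le (by norm_num)]
    omega
  have hb5 : s5 ≤ (d + 4).choose 5 := ncard_circuits_five_le M hd
  have hU1 := topCount_le_ncard_eRk_eq_four_ncard_le M hR hd
  have hU2 := ncard_eRk_eq_four_ncard_le_le_L1 M hcirc hline hplane hten hd
  have hU3 := ncard_eRk_eq_ncard_le_le_split_joint' M 4 10 6 (by norm_num) hcirc hten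
    (fun X hX hr => hplane X hX (by simpa using hr)) hd
  rw [sum_Icc_three_five' (fun k => {C : Set α | M.IsCircuit C ∧ C.ncard = k}.ncard),
    sum_Icc_three_five' (fun k => {C : Set α | M.IsCircuit C ∧ C.ncard = k}.ncard)] at hU3
  have hY := midCount_ge_K M hcirc hline hplane hten hd p
  rw [hn] at hU2 hU3 hY
  obtain ⟨hcell1, hcell2⟩ := cellOK7_spec hok
  -- the bounds dominate the counts
  set m := min (5 * d) (p + d) with hm
  set s3B := min (d * (d + 1) / 2) ((d * d + 6 - 3 * d) / 2) with hs3B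
  set s4B := min (min ((d + 3).choose 4) (d * (d + 1) * (d + 2) / 3)) (fourCircuitBound d) with hs4B
  set piAll := s3 * (p + d - 3).choose 2 + s4 * (p + d - 4) + s5 with hpiAll
  set piS0 := s3 * (m - 3).choose 2 + s4 * (m - 4) + s5 with hpiS0
  set piAllB := s3B * (p + d - 3).choose 2 + s4B * (p + d - 4) + (d + 4).choose 5 with hpiAllB
  set piS0B := s3B * (m - 3).choose 2 + s4B * (m - 4) + (d + 4).choose 5 with hpiS0B
  have hpiAll_le : piAll ≤ piAllB := by
    rw [hpiAll, hpiAllB]; gcongr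
  have hpiS0_le : piS0 ≤ piS0B := by
    rw [hpiS0, hpiS0B]; gcongr
  have hR3_le : 7560 * 22 * (s3 * (p + d - 3) + s4) ≤ 7560 * 22 * (s3B * (p + d - 3) + s4B) := by
    gcongr
  set R34B := 7560 * 22 * (s3B * (p + d - 3) + s4B) + (RSK 10 * piAllB + (RBK 10 - RSK 10) * piS0B) with hR34B
  set sigs := ∑ j ∈ Finset.range (d - 5 + 1), Nat.choose 2 j with hsigs
  set sig := ∑ j ∈ Finset.range (d - 5 + 1), Nat.choose 5 j with hsig
  -- the regrouped per-flat bound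
  set A3 := RSK d * (p + d - 3).choose 2 + (RBK d - RSK d) * (m - 3).choose 2 with hA3
  set A4 := RSK d * (p + d - 4) + (RBK d - RSK d) * (m - 4) with hA4
  set c5 := RSK d + (RBK d - RSK d) with hc5
  set c3 := A3 - 7560 * (p + d - 3) with hc3
  set c4 := A4 - 7560 with hc4
  have hRSK : 7560 ≤ RSK d := Nat.le_add_right _ _
  have hA3ge : 7560 * (p + d - 3) ≤ A3 := by
    have h1 : p + d - 3 ≤ (p + d - 3).choose 2 := le_choose_two _ (by omega)
    calc 7560 * (p + d - 3) ≤ RSK d * (p + d - 3).choose 2 := Nat.mul_le_mul hRSK h1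
      _ ≤ A3 := Nat.le_add_right _ _
  have hA4ge : 7560 ≤ A4 := by
    calc 7560 = 7560 * 1 := by ring
      _ ≤ RSK d * (p + d - 4) := Nat.mul_le_mul hRSK (by omega)
      _ ≤ A4 := Nat.le_add_right _ _
  have hA3eq : A3 = c3 + 7560 * (p + d - 3) := (Nat.sub_add_cancel hA3ge).symm
  have hA4eq : A4 = c4 + 7560 := (Nat.sub_add_cancel hA4ge).symm
  have hident : RSK d * piAll + (RBK d - RSK d) * piS0 = A3 * s3 + A4 * s4 + c5 * s5 := by
    rw [hpiAll, hpiS0, hA3, hA4, hc5]; ring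
  set UB := min (7560 * (p + d).choose 4 + c3 * s3B + c4 * s4B + c5 * (d + 4).choose 5)
    (7560 * ((p + d).choose 4 + sigs * piAllB + (sig - sigs) * piS0B)) with hUB
  set Ysum := 7560 * ∑ j ∈ Finset.Ico 5 p, (p + d).choose j with hYsum
  set phiNum := 2 ^ (p + 4) - 2 * ∑ u ∈ Finset.range 5, (p + 4).choose u with hphiNum
  set phiDen := (p + 4).choose 4 with hphiDen
  -- `7560·#U ≤ UB` (both counts)
  have hUB : 7560 * Matroid.topCount M p 4 ≤ UB := by
    have hU0 : 7560 * Matroid.topCount M p 4 ≤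
        7560 * {B : Set α | B ⊆ M.E ∧ M.eRk B = 4 ∧ B.ncard ≤ d}.ncard := Nat.mul_le_mul_left _ hU1
    refine le_min ?_ ?_
    · -- the L1 branch: `7560·#B + 7560·D(s) ≤ 7560·C(n,4) + A3 s3 + A4 s4 + c5 s5`
      have hL : 7560 * {B : Set α | B ⊆ M.E ∧ M.eRk B = 4 ∧ B.ncard ≤ d}.ncard +
          7560 * (s3 * (p + d - 3) + s4) ≤ 7560 * (p + d).choose 4 + (A3 * s3 + A4 * s4 + c5 * s5) := by
        rw [← hident, ← add_assoc]
        rw [← hs3, ← hs4] at hU2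
        exact hU2
      rw [hA3eq, hA4eq] at hL
      have hL' : 7560 * {B : Set α | B ⊆ M.E ∧ M.eRk B = 4 ∧ B.ncard ≤ d}.ncard ≤
          7560 * (p + d).choose 4 + (c3 * s3 + c4 * s4 + c5 * s5) := by
        have e : 7560 * (p + d).choose 4 + ((c3 + 7560 * (p + d - 3)) * s3 + (c4 + 7560) * s4 + c5 * s5) =
            7560 * (p + d).choose 4 + (c3 * s3 + c4 * s4 + c5 * s5) + 7560 * (s3 * (p + d - 3) + s4) := by ring
        rw [e] at hL
        omega
      calc 7560 * Matroid.topCount M p 4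
          ≤ 7560 * {B : Set α | B ⊆ M.E ∧ M.eRk B = 4 ∧ B.ncard ≤ d}.ncard := hU0
        _ ≤ 7560 * (p + d).choose 4 + (c3 * s3 + c4 * s4 + c5 * s5) := hL'
        _ ≤ 7560 * (p + d).choose 4 + c3 * s3B + c4 * s4B + c5 * (d + 4).choose 5 := by
            have h3 := Nat.mul_le_mul_left c3 hb3
            have h4 := Nat.mul_le_mul_left c4 hb4
            have h5 := Nat.mul_le_mul_left c5 hb5
            omega
    · calc 7560 * Matroid.topCount M p 4
          ≤ 7560 * {B : Set α | B ⊆ M.E ∧ M.eRk B = 4 ∧ B.ncard ≤ d}.ncard := hU0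
        _ ≤ 7560 * ((p + d).choose 4 + sigs * piAll + (sig - sigs) * piS0) := Nat.mul_le_mul_left _ hU3
        _ ≤ 7560 * ((p + d).choose 4 + sigs * piAllB + (sig - sigs) * piS0B) := by gcongr
  -- `Ysum ≤ 7560·#Y + R34B`
  have hYB : Ysum ≤ 7560 * Matroid.midCount M p 4 + R34B := by
    calc Ysum ≤ 7560 * Matroid.midCount M p 4 + 7560 * 22 * (s3 * (p + d - 3) + s4) +
          (RSK 10 * piAll + (RBK 10 - RSK 10) * piS0) := hY
      _ ≤ 7560 * Matroid.midCount M p 4 + R34B := by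
          rw [hR34B]
          have : RSK 10 * piAll + (RBK 10 - RSK 10) * piS0 ≤ RSK 10 * piAllB + (RBK 10 - RSK 10) * piS0B := by
            gcongr
          omega
  -- the `ℕ` chain: `phiNum · (7560·#U) ≤ phiDen · (7560·#Y)`
  have hchain : phiNum * (7560 * Matroid.topCount M p 4) ≤ phiDen * (7560 * Matroid.midCount M p 4) := by
    have h1 : phiNum * (7560 * Matroid.topCount M p 4) ≤ phiNum * UB := Nat.mul_le_mul_left _ hUB
    have h2 : phiNum * UB + phiDen * R34B ≤ phiDen * Ysum := hcell2
    have h3 : phiDen * Ysum ≤ phiDen * (7560 * Matroid.midCount M p 4 + R34B) := Nat.mul_le_mul_left _ hYB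
    rw [Nat.mul_add] at h3
    omega
  -- cast to `ℚ`
  have hsum : 2 * ∑ u ∈ Finset.range 5, (p + 4).choose u ≤ 2 ^ (p + 4) := by
    have := sum_Ioo_choose_add_four p hp
    omega
  have hphiNumQ : (phiNum : ℚ) = 2 ^ (p + 4) - 2 * ∑ u ∈ Finset.range 5, ((p + 4).choose u : ℚ) := by
    rw [hphiNum, Nat.cast_sub hsum]
    push_cast
    ring
  have hΦ := phiK_four_mul_choose_eq p hp
  rw [← hphiNumQ] at hΦ
  have hDenPos : (0 : ℚ) < (phiDen : ℚ) := by
    rw [hphiDen]; exact_mod_cast Nat.choose_pos (by omega)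
  have hchainQ : (phiNum : ℚ) * (Matroid.topCount M p 4 : ℚ) ≤ (phiDen : ℚ) * (Matroid.midCount M p 4 : ℚ) := by
    have h : ((phiNum * (7560 * Matroid.topCount M p 4) : ℕ) : ℚ) ≤
        ((phiDen * (7560 * Matroid.midCount M p 4) : ℕ) : ℚ) := by exact_mod_cast hchain
    push_cast at h
    linarith
  rw [ThmN.RLS_iff]
  have hkey : phiK p 4 * (Matroid.topCount M p 4 : ℚ) * (phiDen : ℚ) ≤
      (Matroid.midCount M p 4 : ℚ) * (phiDen : ℚ) := by
    calc phiK p 4 * (Matroid.topCount M p 4 : ℚ) * (phiDen : ℚ)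
        = (phiK p 4 * (phiDen : ℚ)) * (Matroid.topCount M p 4 : ℚ) := by ring
      _ = (phiNum : ℚ) * (Matroid.topCount M p 4 : ℚ) := by rw [hphiDen, hΦ]
      _ ≤ (phiDen : ℚ) * (Matroid.midCount M p 4 : ℚ) := hchainQ
      _ = (Matroid.midCount M p 4 : ℚ) * (phiDen : ℚ) := by ring
  exact le_of_mul_le_mul_right hkey hDenPos

end S1

end PercRepro
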